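import Summits.Ventures.LatticeQCDFlow.Scoring.SU2AxisCoordinateLaw
import HarnessLib

/-!
# SU(2): the squared modulus of a matrix entry, `|U₀₀|² = a₀² + x₃²`, is UNIFORM on `[0, 1]` under Haar (phase averaging and Wallis' integrals)

HONEST FRAMING: exact (Metropolis-corrected) sampling algorithms for lattice gauge theory;
figures of merit are autocorrelation/cost numbers at stated couplings and volumes; no
continuum-physics claim.

Venture `LatticeQCDFlow` (cell pub-lqcd), sub-topic `Scoring`; FANOUT row 5 (`s0-sun-a`), GEN-9.
NEW WORK of the cell (placement rule).  Step 5b of row 5's route to the exact SU(2) torus formula: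
the one-dimensional law that evaluates the handle integral `∫ χ_n(A U B U⁻¹) dU` (the adjoint-action
identity `SU2Conjugacy.su2a0_commutator_eq` reduces it to a function of `a₀(U)² + ⟨ĉ, x⃗(U)⟩²`).

With `a₀ = Re U₀₀` and `x₃ = su2x genZ3 U = Im U₀₀`, `ρ² := a₀² + x₃² = |U₀₀|² ∈ [0, 1]`.

* §1 `rotZ3 φ = cos φ·1 + sin φ·Z₃ ∈ SU(2)` (the phase subgroup `diag(e^{iφ}, e^{−iφ})`) and
  `su2a0_rotZ3_mul` — `a₀(r_φ·U) = cos φ·a₀(U) − sin φ·x₃(U)`.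
* §2 **PHASE AVERAGING**: `∫₀^π (a cos φ − b sin φ)^(2j) dφ = (a² + b²)^j·∫₀^π cos^(2j)`
  (`integral_linear_trig_pow`: write `a cos φ − b sin φ = ρ cos(φ + ψ)` and use the `π`-periodicity of
  `cos^(2j)`); hence, by LEFT INVARIANCE of Haar and Fubini,
  **`semicircleMoment_eq_wallis_mul`** — `π·S_(2j) = (∫₀^π cos^(2j))·∫ (a₀² + x₃²)^j dHaar`.
* §3 the two recursions (`S`: `SU2AxisCoordinateLaw.semicircleMoment_even_rec`; Wallis:
  `integral_cos_pow`) give **`integral_pow_entryNormSq`** — `∫ (a₀² + x₃²)^j dHaar = 1/(j+1)`;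
  **`map_entryNormSq_haar`** — the law of `a₀² + x₃²` under Haar is Lebesgue measure on `[0, 1]`
  (moment determinacy), i.e. `|U₀₀|²` is uniformly distributed — the `N = 2` case of the fact that a
  row of a Haar unitary is uniform on the sphere.

No new definition (the phase element is written out); nothing cited (folklore).
-/

noncomputable section

open Real MeasureTheory intervalIntegral Set Metric
open Literature.MathematicalPhysics.QuantumFieldTheory Literature.MathematicalPhysics.QuantumLattice
open Summit.Ventures.LatticeQCDFlow.Exactness
open Summit.Ventures.LatticeQCDFlow.Theory2.Lattice

namespace Summit.Ventures.LatticeQCDFlow.Scoring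

/-! ## §1. The phase subgroup `cos φ·1 + sin φ·Z₃` -/

/-- `cos φ·1 + sin φ·Z₃` is special unitary. -/
theorem rotZ3_mem (φ : ℝ) :
    (Real.cos φ : ℂ) • (1 : Matrix (Fin 2) (Fin 2) ℂ) + (Real.sin φ : ℂ) • genZ3 ∈
      Matrix.specialUnitaryGroup (Fin 2) ℂ := by
  have hcs : Real.cos φ ^ 2 + Real.sin φ ^ 2 = 1 := Real.cos_sq_add_sin_sq φ
  rw [Matrix.mem_specialUnitaryGroup_iff]
  refine ⟨?_, ?_⟩
  · rw [Matrix.mem_unitaryGroup_iff]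
    ext i j
    fin_cases i <;> fin_cases j <;>
    · apply Complex.ext <;>
      · simp [genZ3, Matrix.mul_apply, Fin.sum_univ_two, Matrix.one_apply, Complex.mul_re, Complex.mul_im,
          Complex.add_re, Complex.add_im, Complex.cos_ofReal_re, Complex.sin_ofReal_re,
          Complex.cos_ofReal_im, Complex.sin_ofReal_im]
        try nlinarith [hcs]
  · rw [Matrix.det_fin_two]
    apply Complex.ext <;>
    · simp [genZ3, Complex.mul_re, Complex.mul_im, Complex.add_re, Complex.add_im,
        Complex.cos_ofReal_re, Complex.sin_ofReal_re, Complex.cos_ofReal_im, Complex.sin_ofReal_im]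
      try nlinarith [hcs]

/-- **`a₀(r_φ·U) = cos φ·a₀(U) − sin φ·x₃(U)`** for the phase element `r_φ = cos φ·1 + sin φ·Z₃`. -/
theorem su2a0_rotZ3_mul (φ : ℝ) (U : Matrix.specialUnitaryGroup (Fin 2) ℂ) :
    su2a0 ((⟨_, rotZ3_mem φ⟩ : Matrix.specialUnitaryGroup (Fin 2) ℂ) * U) =
      Real.cos φ * su2a0 U - Real.sin φ * su2x genZ3 U := by
  rw [su2a0, su2a0, su2x]
  simp only [Submonoid.coe_mul, Matrix.add_mul, Matrix.smul_mul, Matrix.one_mul, Matrix.trace_add,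
    Matrix.trace_smul, smul_eq_mul, Complex.add_re, Complex.mul_re, Complex.ofReal_re, Complex.ofReal_im,
    zero_mul, sub_zero]
  ring

/-! ## §2. Phase averaging -/

/-- `cos^(2j)` has period `π`. -/
theorem periodic_cos_pow_even (j : ℕ) : Function.Periodic (fun φ : ℝ => Real.cos φ ^ (2 * j)) π := by
  intro φ
  simp only [Real.cos_add_pi, pow_mul, neg_sq]

/-- **Phase averaging**: `∫₀^π (a cos φ − b sin φ)^(2j) dφ = (a² + b²)^j · ∫₀^π cos^(2j) φ dφ`. -/
theorem integral_linear_trig_pow (a b : ℝ) (j : ℕ) :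
    ∫ φ in (0 : ℝ)..π, (a * Real.cos φ - b * Real.sin φ) ^ (2 * j) =
      (a ^ 2 + b ^ 2) ^ j * ∫ φ in (0 : ℝ)..π, Real.cos φ ^ (2 * j) := by
  by_cases hz : a = 0 ∧ b = 0
  · obtain ⟨rfl, rfl⟩ := hz
    rcases Nat.eq_zero_or_pos j with hj | hj
    · subst hj; simp
    · have h2j : 2 * j ≠ 0 := by omega
      simp only [zero_mul, sub_self, zero_pow h2j, intervalIntegral.integral_zero, ne_eq,
        OfNat.ofNat_ne_zero, not_false_eq_true, zero_pow, add_zero, zero_pow hj.ne']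
  · -- polar angle ψ of (a, b): a = ρ cos ψ, b = ρ sin ψ
    set z : ℂ := ⟨a, b⟩ with hz_def
    have hz0 : z ≠ 0 := by
      intro h
      apply hz
      have h1 := congrArg Complex.re h
      have h2 := congrArg Complex.im h
      simp [hz_def] at h1 h2
      exact ⟨h1, h2⟩
    set ρ : ℝ := ‖z‖ with hρ
    set ψ : ℝ := Complex.arg z with hψ
    have hρ0 : 0 < ρ := norm_pos_iff.mpr hz0
    have hcos : Real.cos ψ = a / ρ := by rw [hψ, Complex.cos_arg hz0]
    have hsin : Real.sin ψ = b / ρ := by rw [hψ, Complex.sin_arg]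
    have hρ2 : ρ ^ 2 = a ^ 2 + b ^ 2 := by
      rw [hρ, hz_def, Complex.sq_norm, Complex.normSq_mk]; ring
    have hpt : ∀ φ : ℝ, a * Real.cos φ - b * Real.sin φ = ρ * Real.cos (φ + ψ) := by
      intro φ
      rw [Real.cos_add, hcos, hsin]
      field_simp
    simp_rw [hpt, mul_pow]
    -- shift by ψ and use π-periodicity of cos^(2j)
    have h1 : ∫ φ in (0 : ℝ)..π, Real.cos (φ + ψ) ^ (2 * j) = ∫ φ in (0 : ℝ)..π, Real.cos φ ^ (2 * j) := by
      rw [intervalIntegral.integral_comp_add_right (fun φ => Real.cos φ ^ (2 * j)) ψ, zero_add,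
        add_comm, (periodic_cos_pow_even j).intervalIntegral_add_eq ψ 0, zero_add]
    rw [intervalIntegral.integral_const_mul, pow_mul, hρ2, h1]

/-- Wallis' integral is positive: `0 < ∫₀^π cos^(2j)`. -/
theorem integral_cos_pow_even_pos (j : ℕ) : 0 < ∫ φ in (0 : ℝ)..π, Real.cos φ ^ (2 * j) := by
  rcases Nat.eq_zero_or_pos j with hj | hj
  · subst hj; simp [Real.pi_pos]
  -- positive on (0, π/2) ∪ (π/2, π), nonnegative everywhere: use the lower bound on (0, π/4)… simpler:
  -- ∫₀^π cos^(2j) ≥ 0 with equality iff cos^(2j) = 0 a.e.; we use strict positivity near 0.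
  have hcont : Continuous fun φ : ℝ => Real.cos φ ^ (2 * j) := by fun_prop
  have hnn : ∀ φ, 0 ≤ Real.cos φ ^ (2 * j) := fun φ => by rw [pow_mul]; positivity
  have h1 : 0 < ∫ φ in (0 : ℝ)..(π / 2), Real.cos φ ^ (2 * j) := by
    refine intervalIntegral_pos_of_pos_on (hcont.intervalIntegrable _ _) (fun φ hφ => ?_)
      (by positivity)
    have hc : 0 < Real.cos φ := Real.cos_pos_of_mem_Ioo ⟨by linarith [hφ.1, Real.pi_pos], hφ.2⟩
    positivity
  have h2 : 0 ≤ ∫ φ in (π / 2 : ℝ)..π, Real.cos φ ^ (2 * j) :=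
    intervalIntegral.integral_nonneg (by linarith [Real.pi_pos]) fun φ _ => hnn φ
  rw [← intervalIntegral.integral_add_adjacent_intervals (hcont.intervalIntegrable 0 (π / 2))
    (hcont.intervalIntegrable (π / 2) π)]
  linarith

/-- **`π·S_(2j) = (∫₀^π cos^(2j))·∫ (a₀² + x₃²)^j dHaar`**: the even semicircle moments of `a₀`
against the Haar moments of `|U₀₀|² = a₀² + x₃²` — left invariance under the phase subgroup, then
phase averaging and Fubini. -/
theorem semicircleMoment_eq_wallis_mul (j : ℕ) :
    π * semicircleMoment (2 * j) =
      (∫ φ in (0 : ℝ)..π, Real.cos φ ^ (2 * j)) *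
        ∫ U, (su2a0 U ^ 2 + su2x genZ3 U ^ 2) ^ j ∂(haarProbability (Matrix.specialUnitaryGroup (Fin 2) ℂ)) := by
  -- Step 1: for every φ, S_(2j) = ∫ (cos φ a₀ − sin φ x₃)^(2j) dHaar
  have hφ : ∀ φ : ℝ, semicircleMoment (2 * j) =
      ∫ U, (Real.cos φ * su2a0 U - Real.sin φ * su2x genZ3 U) ^ (2 * j) ∂(haarProbability (Matrix.specialUnitaryGroup (Fin 2) ℂ)) := by
    intro φ
    rw [← su2Moment_zero_eq_semicircleMoment, su2Moment]
    simp only [zero_mul, Real.exp_zero, mul_one]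
    rw [← integral_mul_left_eq_self (fun V : Matrix.specialUnitaryGroup (Fin 2) ℂ => su2a0 V ^ (2 * j))
      ((⟨_, rotZ3_mem φ⟩ : Matrix.specialUnitaryGroup (Fin 2) ℂ))]
    refine integral_congr_ae (Filter.Eventually.of_forall fun U => ?_)
    simp only
    rw [su2a0_rotZ3_mul]
  -- Step 2: integrate over φ ∈ [0, π] and swap
  have hx3c : Continuous fun U : Matrix.specialUnitaryGroup (Fin 2) ℂ => su2x genZ3 U := by
    unfold su2x
    refine ((Complex.continuous_re.comp ?_).neg).div_const _
    exact (continuous_id.matrix_trace).comp (continuous_const.matrix_mul continuous_subtype_val)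
  have hF : Continuous (Function.uncurry fun (φ : ℝ) (U : Matrix.specialUnitaryGroup (Fin 2) ℂ) =>
      (Real.cos φ * su2a0 U - Real.sin φ * su2x genZ3 U) ^ (2 * j)) := by
    have h1 : Continuous fun p : ℝ × Matrix.specialUnitaryGroup (Fin 2) ℂ =>
        Real.cos p.1 * su2a0 p.2 - Real.sin p.1 * su2x genZ3 p.2 :=
      ((Real.continuous_cos.comp continuous_fst).mul (continuous_su2a0.comp continuous_snd)).sub
        ((Real.continuous_sin.comp continuous_fst).mul (hx3c.comp continuous_snd))
    exact h1.pow _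
  -- bound: |cos φ a₀ − sin φ x₃| ≤ 2, so the integrand is bounded by 2^(2j) on a finite measure space
  have hbound : ∀ (φ : ℝ) (U : Matrix.specialUnitaryGroup (Fin 2) ℂ),
      ‖(Real.cos φ * su2a0 U - Real.sin φ * su2x genZ3 U) ^ (2 * j)‖ ≤ (2 : ℝ) ^ (2 * j) := by
    intro φ U
    rw [norm_pow, Real.norm_eq_abs]
    apply pow_le_pow_left₀ (abs_nonneg _)
    have ha : |su2a0 U| ≤ 1 := abs_su2a0_le_one U
    have hx : |su2x genZ3 U| ≤ 1 := by
      have h := su2_sum_sq U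
      have h2 : su2x genZ3 U ^ 2 ≤ 1 := by
        nlinarith [sq_nonneg (su2a0 U), sq_nonneg (su2x genZ1 U), sq_nonneg (su2x genZ2 U)]
      rw [abs_le]
      constructor
      · nlinarith [h2, abs_nonneg (su2x genZ3 U), sq_abs (su2x genZ3 U)]
      · nlinarith [h2, abs_nonneg (su2x genZ3 U), sq_abs (su2x genZ3 U)]
    have h1 : |Real.cos φ * su2a0 U| ≤ 1 := by
      rw [abs_mul]; exact mul_le_one₀ (Real.abs_cos_le_one φ) (abs_nonneg _) ha
    have h2 : |Real.sin φ * su2x genZ3 U| ≤ 1 := by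
      rw [abs_mul]; exact mul_le_one₀ (Real.abs_sin_le_one φ) (abs_nonneg _) hx
    have h1' := abs_le.mp h1
    have h2' := abs_le.mp h2
    exact abs_le.mpr ⟨by linarith [h1'.1, h2'.2], by linarith [h1'.2, h2'.1]⟩
  haveI : IsFiniteMeasure (volume.restrict (Set.uIoc (0 : ℝ) π)) :=
    ⟨by rw [Measure.restrict_apply_univ, Set.uIoc_of_le Real.pi_pos.le]; exact measure_Ioc_lt_top⟩
  have hint : Integrable (Function.uncurry fun (φ : ℝ) (U : Matrix.specialUnitaryGroup (Fin 2) ℂ) =>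
      (Real.cos φ * su2a0 U - Real.sin φ * su2x genZ3 U) ^ (2 * j))
      ((volume.restrict (Set.uIoc (0 : ℝ) π)).prod (haarProbability (Matrix.specialUnitaryGroup (Fin 2) ℂ))) :=
    Integrable.mono' (integrable_const ((2 : ℝ) ^ (2 * j))) hF.aestronglyMeasurable
      (Filter.Eventually.of_forall fun p => hbound p.1 p.2)
  have hswap := MeasureTheory.intervalIntegral_integral_swap hint
  -- left side: ∫₀^π S_(2j) dφ = π S_(2j)
  have hl : ∫ φ in (0 : ℝ)..π, ∫ U, (Real.cos φ * su2a0 U - Real.sin φ * su2x genZ3 U) ^ (2 * j) ∂(haarProbability (Matrix.specialUnitaryGroup (Fin 2) ℂ)) =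
      π * semicircleMoment (2 * j) := by
    simp_rw [← hφ]
    rw [intervalIntegral.integral_const, sub_zero, smul_eq_mul]
  -- right side: ∫_U (a₀² + x₃²)^j K_j
  have hr : ∫ U, (∫ φ in (0 : ℝ)..π, (Real.cos φ * su2a0 U - Real.sin φ * su2x genZ3 U) ^ (2 * j)) ∂(haarProbability (Matrix.specialUnitaryGroup (Fin 2) ℂ)) =
      (∫ φ in (0 : ℝ)..π, Real.cos φ ^ (2 * j)) * ∫ U, (su2a0 U ^ 2 + su2x genZ3 U ^ 2) ^ j ∂(haarProbability (Matrix.specialUnitaryGroup (Fin 2) ℂ)) := by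
    rw [← MeasureTheory.integral_const_mul]
    refine integral_congr_ae (Filter.Eventually.of_forall fun U => ?_)
    have h := integral_linear_trig_pow (su2a0 U) (su2x genZ3 U) j
    have e : (fun φ : ℝ => (su2a0 U * Real.cos φ - su2x genZ3 U * Real.sin φ) ^ (2 * j)) =
        fun φ => (Real.cos φ * su2a0 U - Real.sin φ * su2x genZ3 U) ^ (2 * j) := by
      funext φ; ring_nf
    rw [e] at h
    beta_reduce
    rw [h, mul_comm]
  rw [← hl, hswap, hr]

/-! ## §3. The Haar moments of `|U₀₀|²` and its law -/

/-- **`∫ (a₀² + x₃²)^j dHaar_SU(2) = 1/(j+1)`** — the moments of the uniform law on `[0, 1]`. -/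
theorem integral_pow_entryNormSq (j : ℕ) :
    ∫ U, (su2a0 U ^ 2 + su2x genZ3 U ^ 2) ^ j ∂(haarProbability (Matrix.specialUnitaryGroup (Fin 2) ℂ)) =
      1 / ((j : ℝ) + 1) := by
  induction j with
  | zero => simp
  | succ j ih =>
    have hW := semicircleMoment_eq_wallis_mul (j + 1)
    have hWj := semicircleMoment_eq_wallis_mul j
    have hK : ∫ φ in (0 : ℝ)..π, Real.cos φ ^ (2 * j + 2) =
        (2 * (j : ℝ) + 1) / (2 * j + 2) * ∫ φ in (0 : ℝ)..π, Real.cos φ ^ (2 * j) := by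
      rw [integral_cos_pow, Real.sin_pi, Real.sin_zero]
      push_cast
      ring
    have hS := semicircleMoment_even_rec j
    rw [show 2 * (j + 1) = 2 * j + 2 by ring] at hW
    have hKpos := integral_cos_pow_even_pos j
    have hKpos' := integral_cos_pow_even_pos (j + 1)
    rw [show 2 * (j + 1) = 2 * j + 2 by ring] at hKpos'
    rw [ih] at hWj
    have hπ : (π : ℝ) ≠ 0 := Real.pi_ne_zero
    have hKj : (∫ φ in (0 : ℝ)..π, Real.cos φ ^ (2 * j)) ≠ 0 := hKpos.ne'
    have h24 : (2 * (j : ℝ) + 4) ≠ 0 := by positivity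
    have h22 : (2 * (j : ℝ) + 2) ≠ 0 := by positivity
    have hj1 : ((j : ℝ) + 1) ≠ 0 := by positivity
    have hj2 : (((j + 1 : ℕ) : ℝ) + 1) ≠ 0 := by positivity
    have eS : semicircleMoment (2 * j + 2) = (2 * j + 1) / (2 * (j : ℝ) + 4) * semicircleMoment (2 * j) := by
      field_simp
      linarith [hS]
    have eSj : semicircleMoment (2 * j) =
        (∫ φ in (0 : ℝ)..π, Real.cos φ ^ (2 * j)) * (1 / ((j : ℝ) + 1)) / π := by
      rw [← hWj]; field_simp
    apply mul_left_cancel₀ hKpos'.ne'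
    rw [← hW, eS, eSj, hK]
    field_simp
    push_cast
    ring

/-- `a₀² + x₃² ∈ [0, 1]`. -/
theorem entryNormSq_mem_Icc (U : Matrix.specialUnitaryGroup (Fin 2) ℂ) :
    su2a0 U ^ 2 + su2x genZ3 U ^ 2 ∈ Icc (0 : ℝ) 1 := by
  have h := su2_sum_sq U
  constructor
  · positivity
  · nlinarith [sq_nonneg (su2x genZ1 U), sq_nonneg (su2x genZ2 U)]

/-- The observable `a₀² + x₃²` is measurable. -/
theorem measurable_entryNormSq :
    Measurable fun U : Matrix.specialUnitaryGroup (Fin 2) ℂ => su2a0 U ^ 2 + su2x genZ3 U ^ 2 := by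
  have hx3c : Continuous fun U : Matrix.specialUnitaryGroup (Fin 2) ℂ => su2x genZ3 U := by
    unfold su2x
    refine ((Complex.continuous_re.comp ?_).neg).div_const _
    exact (continuous_id.matrix_trace).comp (continuous_const.matrix_mul continuous_subtype_val)
  exact ((continuous_su2a0.pow 2).add (hx3c.pow 2)).measurable

/-- **The law of `|U₀₀|² = a₀² + x₃²` under Haar on SU(2) is the uniform law on `[0, 1]`.** -/
theorem map_entryNormSq_haar :
    (haarProbability (Matrix.specialUnitaryGroup (Fin 2) ℂ)).map
        (fun U => su2a0 U ^ 2 + su2x genZ3 U ^ 2) = volume.restrict (Icc (0 : ℝ) 1) := by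
  have hm := measurable_entryNormSq
  haveI : IsProbabilityMeasure ((haarProbability (Matrix.specialUnitaryGroup (Fin 2) ℂ)).map
      (fun U => su2a0 U ^ 2 + su2x genZ3 U ^ 2)) := Measure.isProbabilityMeasure_map hm.aemeasurable
  haveI : IsFiniteMeasure (volume.restrict (Icc (0 : ℝ) 1)) :=
    ⟨by rw [Measure.restrict_apply_univ]; exact measure_Icc_lt_top⟩
  refine measure_eq_of_forall_integral_pow_eq (a := 0) (b := 1) ?_ ?_ fun k => ?_
  · rw [Measure.map_apply hm measurableSet_Icc.compl]
    have : (fun U : Matrix.specialUnitaryGroup (Fin 2) ℂ => su2a0 U ^ 2 + su2x genZ3 U ^ 2) ⁻¹'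
        (Icc (0 : ℝ) 1)ᶜ = ∅ := by
      ext U
      simp only [mem_preimage, mem_compl_iff, mem_empty_iff_false, iff_false, not_not]
      exact entryNormSq_mem_Icc U
    rw [this, measure_empty]
  · rw [Measure.restrict_apply measurableSet_Icc.compl, compl_inter_self, measure_empty]
  · rw [integral_map hm.aemeasurable (continuous_pow k).aestronglyMeasurable, integral_pow_entryNormSq]
    have h : ∫ s in Icc (0 : ℝ) 1, s ^ k = ∫ s in (0 : ℝ)..1, s ^ k := by
      rw [intervalIntegral.integral_of_le zero_le_one, integral_Icc_eq_integral_Ioc]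
    rw [h, integral_pow]
    simp

/-- **Integral form**: for every continuous `g`, `∫ g(a₀² + x₃²) dHaar_SU(2) = ∫₀¹ g(v) dv`. -/
theorem integral_comp_entryNormSq (g : ℝ → ℝ) (hg : Continuous g) :
    ∫ U, g (su2a0 U ^ 2 + su2x genZ3 U ^ 2) ∂(haarProbability (Matrix.specialUnitaryGroup (Fin 2) ℂ)) =
      ∫ v in (0 : ℝ)..1, g v := by
  rw [← integral_map measurable_entryNormSq.aemeasurable hg.aestronglyMeasurable, map_entryNormSq_haar,
    intervalIntegral.integral_of_le zero_le_one, integral_Icc_eq_integral_Ioc]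

end Summit.Ventures.LatticeQCDFlow.Scoring
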